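import Summits.AtomisticToContinuum.HydrodynamicLimit.Theorems.AntiMazurCoboundariesKineticWindowGronwallClusterVirialIdentity
import Literature.Analysis.FluidPDE.CollisionalTransferFunctional
import HarnessLib

/-!
# The cluster virial budget (stub `stub_clusterVirialBudget`)

Crux `Summit.AtomisticToContinuum.HydrodynamicLimit.Theses.AntiMazurCoboundaries.KineticWindowGronwall`
(stmt-AtomisticToContinuum-9282), line `explosion-limited-jamming`, stub
`stub_clusterVirialBudget : ClusterVirialBudget` — the deterministic lever of the line: the centre-of-mass
Lagrange–Jacobi (Clausius virial) budget of a cluster `S` of hard spheres in `ℝ³` (Cercignani–Illner–Pulvirenti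
1994, Lemma 4.2.3; Vaserstein 1979; Illner 1989). The cluster quantities `cmPos, cmVel, cmVirial, cmInertia,
cmKinetic` and the configuration-level identities are in the helper file `…ClusterVirialIdentity` (helper stub
`stub_clusterVirialIdentity`); `internalImpulse`, `externalImpulse` and `ClusterVirialBudget` are re-declared here
verbatim from the line skeleton `Cruxes/KineticWindowGronwall/Lines/explosion-limited-jamming.lean`.

Along a hard-sphere trajectory, at a collision of `{i, j}` the virial jumps by
`[i ∈ S] ⟪x_i − X_S, Δv_i⟫ + [j ∈ S] ⟪x_j − X_S, Δv_j⟫` (`collisionJump_cmVirial`): `ε ‖Δv_i‖` internally (transfer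
along the line of centres, `inner_sub_vel_sub_leftLim`), `0` for two outsiders, `≥ −R ‖Δv_i‖` externally
(`le_collisionJump_cmVirial`); internal / outsider collisions keep `K_S` (`cmKinetic_eq_leftLim`); `internalImpulse`
counts both ordered records of an internal collision (`sum_contactPairs_intF`), `externalImpulse` the one record
`(i, j)`, `i ∈ S ∌ j` (`sum_contactPairs_extF`). The weak balance law
`IsHardSphereTrajectory.sub_eq_integral_add_collisionalTransfer` for `F = cmVirial S`, `F' = 2 cmKinetic S`
(`cmVirial_sub_eq`) and `|b_S| ≤ √(2 K_S I_S)` give `fed_budget`; on an isolation window `K_S` is constant and `√I_S`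
is `√(2K_S)`-Lipschitz (`iso_kinetic_eq_and_sqrt_inertia_le`, induction on the collision times) — `isolated_budget`.
-/

noncomputable section

open scoped BigOperators ENNReal InnerProductSpace
open MeasureTheory Set Filter Topology Function
open Literature.MathematicalPhysics.KineticTheory (V3)
open Literature.Analysis.FluidPDE

namespace Summit.AtomisticToContinuum.HydrodynamicLimit.Theorems.KineticWindowGronwallClusterVirial

/-! ## Impulses and the statement (verbatim from the line skeleton) -/

section Statement

open scoped Classical

section Cluster

variable {n : ℕ}

/-- Internal impulse of `S` over the times in `I` along the curve `γ` (Euclidean geometry, diameter `ε`):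
`Σ_{collisions (i,j), i,j ∈ S, ordered} ‖v_i⁺ − v_i⁻‖ = 2 Σ_{internal collisions} |[v]|`.
[cite: CIP1994, Lemma 4.2.3] -/
def internalImpulse (ε : ℝ) (γ : ℝ → Config n (Fin 3) V3) (S : Finset (Fin n)) (I : Set ℝ) : ℝ :=
  Literature.Analysis.FluidPDE.collisionSum (Euclidean.geometry (Fin 3)) ε γ I
    (fun c => if c.fst ∈ S ∧ c.snd ∈ S then ‖c.postVel.1 - c.preVel.1‖ else 0)

/-- External impulse received by `S` over the times in `I`:
`Σ_{collisions (i,j), i ∈ S, j ∉ S} ‖v_i⁺ − v_i⁻‖`. [cite: CIP1994, Lemma 4.2.3] -/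
def externalImpulse (ε : ℝ) (γ : ℝ → Config n (Fin 3) V3) (S : Finset (Fin n)) (I : Set ℝ) : ℝ :=
  Literature.Analysis.FluidPDE.collisionSum (Euclidean.geometry (Fin 3)) ε γ I
    (fun c => if c.fst ∈ S ∧ c.snd ∉ S then ‖c.postVel.1 - c.preVel.1‖ else 0)

end Cluster

/-- **CLUSTER VIRIAL BUDGET** (the deterministic lever; two conjuncts). For every hard-sphere trajectory `γ` of `n`
spheres of diameter `ε > 0` in `ℝ³` (`IsHardSphereTrajectory`), every cluster `S` and times `t₁ ≤ t₂`:
(ISOLATED) if no contact pair straddles `S` on `[t₁, t₂]`, then `ε · internalImpulse ≤ 4 √(2 K_S I_S)(t₁)`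
(CM-frame Lagrange–Jacobi; the factor 4 = 2 × ordered pairs); (FED) if `‖x_a(t) − X_S(t)‖ ≤ R` for `a ∈ S`,
`t ∈ [t₁,t₂]`, then `ε · internalImpulse ≤ 2√(2K_S I_S)(t₁) + 2√(2K_S I_S)(t₂) + 2 R · externalImpulse`.
Proved below (`stub_clusterVirialBudget`); Cercignani–Illner–Pulvirenti 1994 Lemma 4.2.3 (Remark p. 66: false on
`Λ ≠ ℝ³` — whence clusters), Vaserstein 1979, Illner 1989, Burago–Ferleger–Kononenko 1998. -/
def ClusterVirialBudget : Prop :=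
  (∀ (ε : ℝ) (n : ℕ) (γ : ℝ → Config n (Fin 3) V3), 0 < ε →
    IsHardSphereTrajectory (Euclidean.geometry (Fin 3)) ε n γ →
    ∀ (S : Finset (Fin n)) (t₁ t₂ : ℝ), t₁ ≤ t₂ →
    (∀ t ∈ Set.Icc t₁ t₂, ∀ p ∈ contactPairs (Euclidean.geometry (Fin 3)) ε (γ t), p.1 ∈ S → p.2 ∈ S) →
    ε * internalImpulse ε γ S (Set.Ioc t₁ t₂) ≤
      4 * Real.sqrt (2 * cmKinetic S (γ t₁) * cmInertia S (γ t₁))) ∧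
  (∀ (ε : ℝ) (n : ℕ) (γ : ℝ → Config n (Fin 3) V3), 0 < ε →
    IsHardSphereTrajectory (Euclidean.geometry (Fin 3)) ε n γ →
    ∀ (S : Finset (Fin n)) (t₁ t₂ R : ℝ), t₁ ≤ t₂ →
    (∀ t ∈ Set.Icc t₁ t₂, ∀ a ∈ S, ‖(γ t a).1 - cmPos S (γ t)‖ ≤ R) →
    ε * internalImpulse ε γ S (Set.Ioc t₁ t₂) ≤
      2 * Real.sqrt (2 * cmKinetic S (γ t₁) * cmInertia S (γ t₁)) +
      2 * Real.sqrt (2 * cmKinetic S (γ t₂) * cmInertia S (γ t₂)) +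
      2 * R * externalImpulse ε γ S (Set.Ioc t₁ t₂))

end Statement

/-! ## Along a hard-sphere trajectory in `ℝ³` -/

section Trajectory

variable {n : ℕ} (S : Finset (Fin n))

/-- Shorthand for the Euclidean geometry of `ℝ³`. [folklore] -/
local notation "G3" => Euclidean.geometry (Fin 3)

variable {S} {ε : ℝ} {γ : ℝ → Config n (Fin 3) V3}

/-- `ℝ³` is a regular geometry at every diameter. [folklore] -/
theorem isHardSphereRegular_G3 (ε : ℝ) : (G3).IsHardSphereRegular ε :=
  Euclidean.isHardSphereRegular_geometry ε

/-- Translations of `ℝ³` are continuous. [folklore] -/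
theorem continuous_translate_G3 (x : V3) : Continuous ((G3).translate x) :=
  (isHardSphereRegular_G3 0).continuous_translate_left x

/-- The internal-impulse summand of `internalImpulse`. [folklore] -/
def intF (S : Finset (Fin n)) (c : HardSphereCollisionRecord (Fin 3) V3 n) : ℝ :=
  if c.fst ∈ S ∧ c.snd ∈ S then ‖c.postVel.1 - c.preVel.1‖ else 0

/-- The external-impulse summand of `externalImpulse`. [folklore] -/
def extF (S : Finset (Fin n)) (c : HardSphereCollisionRecord (Fin 3) V3 n) : ℝ :=
  if c.fst ∈ S ∧ c.snd ∉ S then ‖c.postVel.1 - c.preVel.1‖ else 0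

/-- `internalImpulse` as a finite sum over the collision times of a window `(t₁, t₂]`. [folklore] -/
theorem internalImpulse_eq_sum (h : IsHardSphereTrajectory G3 ε n γ) (S : Finset (Fin n)) (t₁ t₂ : ℝ) :
    internalImpulse ε γ S (Ioc t₁ t₂) = ∑ t ∈ (h.finite_collisionTimes_inter_Ioc t₁ t₂).toFinset,
      ∑ p ∈ contactPairs G3 ε (γ t), intF S (HardSphereCollisionRecord.ofConfig G3 ε (γ t) t p.1 p.2) :=
  collisionSum_eq_finset_sum _ _

/-- `externalImpulse` as a finite sum over the collision times of a window `(t₁, t₂]`. [folklore] -/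
theorem externalImpulse_eq_sum (h : IsHardSphereTrajectory G3 ε n γ) (S : Finset (Fin n)) (t₁ t₂ : ℝ) :
    externalImpulse ε γ S (Ioc t₁ t₂) = ∑ t ∈ (h.finite_collisionTimes_inter_Ioc t₁ t₂).toFinset,
      ∑ p ∈ contactPairs G3 ε (γ t), extF S (HardSphereCollisionRecord.ofConfig G3 ε (γ t) t p.1 p.2) :=
  collisionSum_eq_finset_sum _ _

variable (S)

/-- **The jump of the cluster virial at a collision** of `{i, j}`:
`[i ∈ S] ⟪x_i − X_S, Δv_i⟫ + [j ∈ S] ⟪x_j − X_S, Δv_j⟫`. [folklore] -/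
theorem collisionJump_cmVirial (h : IsHardSphereTrajectory G3 ε n γ) {t : ℝ} {i j : Fin n} (hij : i ≠ j)
    (hc : γ t ∈ contactSet G3 n ε i j) :
    collisionJump (cmVirial S) γ t =
      (if i ∈ S then ⟪(γ t i).1 - cmPos S (γ t), (γ t i).2 - (leftLim γ t i).2⟫_ℝ else 0) +
      (if j ∈ S then ⟪(γ t j).1 - cmPos S (γ t), (γ t j).2 - (leftLim γ t j).2⟫_ℝ else 0) :=
  cmVirial_sub_of_collision hij (fun k => h.leftLim_apply_fst continuous_translate_G3 t k)
    fun _ hki hkj => h.apply_eq_leftLim_apply_of_ne hij hc hki hkj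

/-- Internal and outsider collisions keep the CM kinetic energy of `S`. [folklore] -/
theorem cmKinetic_eq_leftLim (h : IsHardSphereTrajectory G3 ε n γ) {t : ℝ} {i j : Fin n} (hij : i ≠ j)
    (hc : γ t ∈ contactSet G3 n ε i j) (hS : i ∈ S ↔ j ∈ S) :
    cmKinetic S (γ t) = cmKinetic S (leftLim γ t) :=
  cmKinetic_eq_of_collision hij (fun _ hki hkj => h.apply_eq_leftLim_apply_of_ne hij hc hki hkj)
    (h.vel_add_vel_eq_leftLim hij hc) (h.norm_sq_vel_add_eq_leftLim hij hc) hS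

/-- **The internal jump is `ε ‖Δv_i‖`**: the momentum transfer is along the line of centres,
`⟪x_i − x_j, Δv_i⟫ = ε ‖Δv_i‖`. [folklore] -/
theorem inner_sub_vel_sub_leftLim (h : IsHardSphereTrajectory G3 ε n γ) {t : ℝ} {i j : Fin n} (hij : i ≠ j)
    (hc : γ t ∈ contactSet G3 n ε i j) :
    ⟪(γ t i).1 - (γ t j).1, (γ t i).2 - (leftLim γ t i).2⟫_ℝ = ε * ‖(γ t i).2 - (leftLim γ t i).2‖ := by
  have hsmul := h.vel_sub_leftLim_eq_smul continuous_translate_G3 hij hc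
  have hp := h.inner_sepVec_vel_sub_leftLim_pos continuous_translate_G3 hij hc
  have hnorm : ‖(G3).sepVec (γ t i).1 (γ t j).1‖ = ε := (mem_contactSet.1 hc).2
  rw [Euclidean.geometry_sepVec] at hsmul hp hnorm
  rw [inner_eq_norm_mul_norm_of_eq_smul hsmul hp, hnorm]

/-- The internal summands at a collision of `{i, j}` add up to `[i, j ∈ S] · 2 ‖Δv_i‖`. [folklore] -/
theorem sum_contactPairs_intF (h : IsHardSphereTrajectory G3 ε n γ) {t : ℝ} {i j : Fin n} (hij : i ≠ j)
    (hc : γ t ∈ contactSet G3 n ε i j) :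
    ∑ p ∈ contactPairs G3 ε (γ t), intF S (HardSphereCollisionRecord.ofConfig G3 ε (γ t) t p.1 p.2) =
      if i ∈ S ∧ j ∈ S then 2 * ‖(γ t i).2 - (leftLim γ t i).2‖ else 0 := by
  have hp : (i, j) ∈ contactPairs G3 ε (γ t) := mem_contactPairs.2 ⟨hij, hc⟩
  have hp' : (j, i) ∈ contactPairs G3 ε (γ t) := (swap_mem_contactPairs_iff (isHardSphereRegular_G3 ε)).2 hp
  have hne : (i, j) ≠ (j, i) := fun e => hij (Prod.mk.inj e).1
  rw [h.contactPairs_eq_pair (isHardSphereRegular_G3 ε) hp, Finset.sum_pair hne]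
  simp only [intF, HardSphereCollisionRecord.ofConfig_fst, HardSphereCollisionRecord.ofConfig_snd,
    HardSphereCollisionRecord.ofConfig_postVel, h.ofConfig_preVel_eq_leftLim hp,
    h.ofConfig_preVel_eq_leftLim hp', h.vel_sub_leftLim_right_eq_neg hij hc, norm_neg]
  by_cases hi : i ∈ S
  · by_cases hj : j ∈ S
    · rw [if_pos ⟨hi, hj⟩, if_pos ⟨hj, hi⟩, if_pos ⟨hi, hj⟩, two_mul]
    · rw [if_neg (fun h' => hj h'.2), if_neg (fun h' => hj h'.1), if_neg (fun h' => hj h'.2), add_zero]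
  · rw [if_neg (fun h' => hi h'.1), if_neg (fun h' => hi h'.2), if_neg (fun h' => hi h'.1), add_zero]

/-- The external summands at a collision of `{i, j}` add up to `([i ∈ S ∌ j] + [j ∈ S ∌ i]) ‖Δv_i‖`.
[folklore] -/
theorem sum_contactPairs_extF (h : IsHardSphereTrajectory G3 ε n γ) {t : ℝ} {i j : Fin n} (hij : i ≠ j)
    (hc : γ t ∈ contactSet G3 n ε i j) :
    ∑ p ∈ contactPairs G3 ε (γ t), extF S (HardSphereCollisionRecord.ofConfig G3 ε (γ t) t p.1 p.2) =
      (if i ∈ S ∧ j ∉ S then ‖(γ t i).2 - (leftLim γ t i).2‖ else 0) +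
      (if j ∈ S ∧ i ∉ S then ‖(γ t i).2 - (leftLim γ t i).2‖ else 0) := by
  have hp : (i, j) ∈ contactPairs G3 ε (γ t) := mem_contactPairs.2 ⟨hij, hc⟩
  have hp' : (j, i) ∈ contactPairs G3 ε (γ t) := (swap_mem_contactPairs_iff (isHardSphereRegular_G3 ε)).2 hp
  have hne : (i, j) ≠ (j, i) := fun e => hij (Prod.mk.inj e).1
  rw [h.contactPairs_eq_pair (isHardSphereRegular_G3 ε) hp, Finset.sum_pair hne]
  simp only [extF, HardSphereCollisionRecord.ofConfig_fst, HardSphereCollisionRecord.ofConfig_snd,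
    HardSphereCollisionRecord.ofConfig_postVel, h.ofConfig_preVel_eq_leftLim hp,
    h.ofConfig_preVel_eq_leftLim hp', h.vel_sub_leftLim_right_eq_neg hij hc, norm_neg]

/-- **Per-collision budget (FED)**: if every member of `S` is within `R` of the centre of mass at the collision
time `t`, then `(ε/2) · (internal summands) − R · (external summands) ≤ jump of b_S`. [folklore] -/
theorem le_collisionJump_cmVirial (h : IsHardSphereTrajectory G3 ε n γ) {t : ℝ} (ht : t ∈ collisionTimes G3 ε γ)
    {R : ℝ} (hR : ∀ a ∈ S, ‖(γ t a).1 - cmPos S (γ t)‖ ≤ R) :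
    ε / 2 * (∑ p ∈ contactPairs G3 ε (γ t), intF S (HardSphereCollisionRecord.ofConfig G3 ε (γ t) t p.1 p.2)) -
        R * (∑ p ∈ contactPairs G3 ε (γ t), extF S (HardSphereCollisionRecord.ofConfig G3 ε (γ t) t p.1 p.2)) ≤
      collisionJump (cmVirial S) γ t := by
  obtain ⟨i, j, hij, hc⟩ := mem_collisionTimes.1 ht
  rw [collisionJump_cmVirial S h hij hc, sum_contactPairs_intF S h hij hc, sum_contactPairs_extF S h hij hc,
    h.vel_sub_leftLim_right_eq_neg hij hc, inner_neg_right]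
  have hint := inner_sub_vel_sub_leftLim h hij hc
  have hΔ := norm_nonneg ((γ t i).2 - (leftLim γ t i).2)
  by_cases hi : i ∈ S
  · by_cases hj : j ∈ S
    · rw [if_pos hi, if_pos hj, if_pos ⟨hi, hj⟩, if_neg (fun h' => h'.2 hj), if_neg (fun h' => h'.2 hi),
        add_zero, mul_zero, sub_zero, ← sub_eq_add_neg, ← inner_sub_left, sub_sub_sub_cancel_right, hint]
      linarith
    · rw [if_pos hi, if_neg hj, if_neg (fun h' => hj h'.2), if_pos ⟨hi, hj⟩, if_neg (fun h' => hj h'.1),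
        add_zero, add_zero, mul_zero, zero_sub]
      have h1 := (abs_le.1 (abs_real_inner_le_norm ((γ t i).1 - cmPos S (γ t))
        ((γ t i).2 - (leftLim γ t i).2))).1
      have h2 := mul_le_mul_of_nonneg_right (hR i hi) hΔ
      linarith
  · by_cases hj : j ∈ S
    · rw [if_neg hi, if_pos hj, if_neg (fun h' => hi h'.1), if_neg (fun h' => hi h'.1), if_pos ⟨hj, hi⟩,
        zero_add, zero_add, mul_zero, zero_sub]
      have h1 := (abs_le.1 (abs_real_inner_le_norm ((γ t j).1 - cmPos S (γ t))
        ((γ t i).2 - (leftLim γ t i).2))).2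
      have h2 := mul_le_mul_of_nonneg_right (hR j hj) hΔ
      linarith
    · rw [if_neg hi, if_neg hj, if_neg (fun h' => hi h'.1), if_neg (fun h' => hi h'.1),
        if_neg (fun h' => hj h'.1)]
      simp

/-- **Per-collision identity (ISOLATED)**: if the colliding pair does not straddle `S`, the jump of `b_S` is
exactly `(ε/2) · (internal summands)`. [folklore] -/
theorem collisionJump_cmVirial_eq_of_iso (h : IsHardSphereTrajectory G3 ε n γ) {t : ℝ}
    (ht : t ∈ collisionTimes G3 ε γ) (hiso : ∀ p ∈ contactPairs G3 ε (γ t), p.1 ∈ S → p.2 ∈ S) :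
    collisionJump (cmVirial S) γ t =
      ε / 2 * ∑ p ∈ contactPairs G3 ε (γ t), intF S (HardSphereCollisionRecord.ofConfig G3 ε (γ t) t p.1 p.2) := by
  obtain ⟨i, j, hij, hc⟩ := mem_collisionTimes.1 ht
  have hp : (i, j) ∈ contactPairs G3 ε (γ t) := mem_contactPairs.2 ⟨hij, hc⟩
  have hp' : (j, i) ∈ contactPairs G3 ε (γ t) := (swap_mem_contactPairs_iff (isHardSphereRegular_G3 ε)).2 hp
  have hS : i ∈ S ↔ j ∈ S := ⟨hiso _ hp, hiso _ hp'⟩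
  rw [collisionJump_cmVirial S h hij hc, sum_contactPairs_intF S h hij hc]
  by_cases hi : i ∈ S
  · have hj := hS.1 hi
    rw [if_pos hi, if_pos hj, if_pos ⟨hi, hj⟩, h.vel_sub_leftLim_right_eq_neg hij hc, inner_neg_right,
      ← sub_eq_add_neg, ← inner_sub_left, sub_sub_sub_cancel_right, inner_sub_vel_sub_leftLim h hij hc]
    ring
  · have hj : j ∉ S := fun hj => hi (hS.2 hj)
    rw [if_neg hi, if_neg hj, if_neg (fun h' => hi h'.1), add_zero, mul_zero]

/-- **The weak balance law for the cluster virial**: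
`b_S(t₂) − b_S(t₁) = ∫_{t₁}^{t₂} 2 K_S ds + Σ_{t_c ∈ (t₁, t₂]} Δb_S(t_c)`. [folklore] -/
theorem cmVirial_sub_eq (h : IsHardSphereTrajectory G3 ε n γ) {t₁ t₂ : ℝ} (h12 : t₁ ≤ t₂) :
    cmVirial S (γ t₂) - cmVirial S (γ t₁) = (∫ s in t₁..t₂, 2 * cmKinetic S (γ s)) +
      ∑ t ∈ (h.finite_collisionTimes_inter_Ioc t₁ t₂).toFinset, collisionJump (cmVirial S) γ t := by
  obtain ⟨-, heq⟩ := h.sub_eq_integral_add_collisionalTransfer (F := cmVirial S)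
    (F' := fun z => 2 * cmKinetic S z) continuous_translate_G3 (hasDerivAt_cmVirial_freeFlight S)
    (fun z => by simp only [cmKinetic_freeFlight]; exact continuous_const) h12
  rw [heq, collisionalTransfer_eq_sum]

/-- **Isolation windows**: if no contact pair straddles `S` on `[a, b]`, then `K_S(b) = K_S(a)` and
`√I_S(b) ≤ √I_S(a) + √(2 K_S(a)) (b − a)` (induction on the number of collision times in `(a, b]`: free
flight in between, `cmKinetic_eq_leftLim` and continuity of the positions at the collisions). [folklore] -/
theorem iso_kinetic_eq_and_sqrt_inertia_le (h : IsHardSphereTrajectory G3 ε n γ) {b : ℝ} :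
    ∀ (m : ℕ) {a : ℝ}, a ≤ b →
      (∀ t ∈ Icc a b, ∀ p ∈ contactPairs G3 ε (γ t), p.1 ∈ S → p.2 ∈ S) →
      (h.finite_collisionTimes_inter_Ioc a b).toFinset.card = m →
      cmKinetic S (γ b) = cmKinetic S (γ a) ∧
        Real.sqrt (cmInertia S (γ b)) ≤
          Real.sqrt (cmInertia S (γ a)) + Real.sqrt (2 * cmKinetic S (γ a)) * (b - a) := by
  intro m
  induction m with
  | zero =>
    intro a hab _ hcard
    rw [Finset.card_eq_zero] at hcard
    have hfree : ∀ σ ∈ Ioc a b, σ ∉ collisionTimes G3 ε γ := fun σ hσ hcol =>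
      Finset.notMem_empty σ (hcard ▸ (Set.Finite.mem_toFinset _).2 ⟨hcol, hσ⟩)
    rw [h.free a b hab hfree]
    exact ⟨cmKinetic_freeFlight S _ _, sqrt_cmInertia_freeFlight_le S (sub_nonneg.2 hab) _⟩
  | succ m ih =>
    intro a hab hiso hcard
    set F := (h.finite_collisionTimes_inter_Ioc a b).toFinset with hF
    have hne : F.Nonempty := Finset.card_pos.1 (by omega)
    have hTmem : F.min' hne ∈ collisionTimes G3 ε γ ∩ Ioc a b := (Set.Finite.mem_toFinset _).1 (F.min'_mem hne)
    set T := F.min' hne with hT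
    have haT : a < T := hTmem.2.1
    have hTb : T ≤ b := hTmem.2.2
    have hmemF : ∀ {σ}, σ ∈ collisionTimes G3 ε γ → a < σ → σ ≤ b → σ ∈ F := fun hσ haσ hσb =>
      (Set.Finite.mem_toFinset _).2 ⟨hσ, haσ, hσb⟩
    have hfree : ∀ σ ∈ Ioo a T, σ ∉ collisionTimes G3 ε γ := fun σ hσ hcol =>
      (not_lt.2 (F.min'_le σ (hmemF hcol hσ.1 (hσ.2.le.trans hTb)))) hσ.2
    have hcard' : (h.finite_collisionTimes_inter_Ioc T b).toFinset.card = m := by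
      have hE : (h.finite_collisionTimes_inter_Ioc T b).toFinset = F.erase T := by
        ext σ
        simp only [Set.Finite.mem_toFinset, Finset.mem_erase, mem_inter_iff, mem_Ioc]
        constructor
        · rintro ⟨hσ, hTσ, hσb⟩
          exact ⟨hTσ.ne', hmemF hσ (haT.trans hTσ) hσb⟩
        · rintro ⟨hne', hσF⟩
          obtain ⟨hσ, haσ, hσb⟩ := (Set.Finite.mem_toFinset _).1 hσF
          exact ⟨hσ, lt_of_le_of_ne (F.min'_le σ hσF) (Ne.symm hne'), hσb⟩
      rw [hE, Finset.card_erase_of_mem (F.min'_mem hne), hcard]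
      rfl
    obtain ⟨hKb, hIb⟩ := ih hTb (fun t ht => hiso t ⟨haT.le.trans ht.1, ht.2⟩) hcard'
    -- the collision at `T`
    obtain ⟨i, j, hij, hc⟩ := mem_collisionTimes.1 hTmem.1
    have hp : (i, j) ∈ contactPairs G3 ε (γ T) := mem_contactPairs.2 ⟨hij, hc⟩
    have hp' : (j, i) ∈ contactPairs G3 ε (γ T) :=
      (swap_mem_contactPairs_iff (isHardSphereRegular_G3 ε)).2 hp
    have hS : i ∈ S ↔ j ∈ S := ⟨hiso T ⟨haT.le, hTb⟩ _ hp, hiso T ⟨haT.le, hTb⟩ _ hp'⟩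
    have hleft : leftLim γ T = freeFlight G3 (T - a) (γ a) :=
      h.leftLim_eq_freeFlight continuous_translate_G3 haT hfree
    have hKT : cmKinetic S (γ T) = cmKinetic S (γ a) := by
      rw [cmKinetic_eq_leftLim S h hij hc hS, hleft, cmKinetic_freeFlight]
    have hIT : Real.sqrt (cmInertia S (γ T)) ≤
        Real.sqrt (cmInertia S (γ a)) + Real.sqrt (2 * cmKinetic S (γ a)) * (T - a) := by
      rw [← cmInertia_eq_of_pos_eq (fun k => h.leftLim_apply_fst continuous_translate_G3 T k), hleft]
      exact sqrt_cmInertia_freeFlight_le S (sub_nonneg.2 haT.le) _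
    refine ⟨hKb.trans hKT, ?_⟩
    calc Real.sqrt (cmInertia S (γ b))
        ≤ Real.sqrt (cmInertia S (γ T)) + Real.sqrt (2 * cmKinetic S (γ T)) * (b - T) := hIb
      _ ≤ Real.sqrt (cmInertia S (γ a)) + Real.sqrt (2 * cmKinetic S (γ a)) * (T - a) +
            Real.sqrt (2 * cmKinetic S (γ a)) * (b - T) := by rw [hKT]; exact add_le_add hIT le_rfl
      _ = Real.sqrt (cmInertia S (γ a)) + Real.sqrt (2 * cmKinetic S (γ a)) * (b - a) := by ring

/-- **The ISOLATED budget**: `ε · internalImpulse ≤ 4 √(2 K_S I_S)(t₁)` on an isolation window.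
[cite: CIP1994, Lemma 4.2.3] -/
theorem isolated_budget (h : IsHardSphereTrajectory G3 ε n γ) {t₁ t₂ : ℝ} (h12 : t₁ ≤ t₂)
    (hiso : ∀ t ∈ Icc t₁ t₂, ∀ p ∈ contactPairs G3 ε (γ t), p.1 ∈ S → p.2 ∈ S) :
    ε * internalImpulse ε γ S (Ioc t₁ t₂) ≤ 4 * Real.sqrt (2 * cmKinetic S (γ t₁) * cmInertia S (γ t₁)) := by
  have hbal := cmVirial_sub_eq S h h12
  have hK : ∀ s ∈ Icc t₁ t₂, cmKinetic S (γ s) = cmKinetic S (γ t₁) := fun s hs =>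
    (iso_kinetic_eq_and_sqrt_inertia_le S h _ hs.1 (fun t ht => hiso t ⟨ht.1, ht.2.trans hs.2⟩) rfl).1
  have hsqI := (iso_kinetic_eq_and_sqrt_inertia_le S h _ h12 hiso rfl).2
  have hInt : ∫ s in t₁..t₂, 2 * cmKinetic S (γ s) = (t₂ - t₁) * (2 * cmKinetic S (γ t₁)) := by
    rw [intervalIntegral.integral_congr (g := fun _ => 2 * cmKinetic S (γ t₁)) fun s hs => ?_,
      intervalIntegral.integral_const, smul_eq_mul]
    rw [uIcc_of_le h12] at hs
    simp only [hK s hs]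
  have hjumps : ∑ t ∈ (h.finite_collisionTimes_inter_Ioc t₁ t₂).toFinset, collisionJump (cmVirial S) γ t =
      ε / 2 * internalImpulse ε γ S (Ioc t₁ t₂) := by
    rw [internalImpulse_eq_sum h, Finset.mul_sum]
    refine Finset.sum_congr rfl fun t ht => ?_
    obtain ⟨htc, ht12⟩ := (Set.Finite.mem_toFinset _).1 ht
    exact collisionJump_cmVirial_eq_of_iso S h htc (hiso t (Ioc_subset_Icc_self ht12))
  have hK0 : 0 ≤ 2 * cmKinetic S (γ t₁) := mul_nonneg zero_le_two (cmKinetic_nonneg S _)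
  have hb2 : cmVirial S (γ t₂) ≤ Real.sqrt (2 * cmKinetic S (γ t₁)) * Real.sqrt (cmInertia S (γ t₁)) +
      2 * cmKinetic S (γ t₁) * (t₂ - t₁) := by
    calc cmVirial S (γ t₂) ≤ Real.sqrt (2 * cmKinetic S (γ t₂)) * Real.sqrt (cmInertia S (γ t₂)) := by
          rw [← sqrt_two_mul_cmKinetic_mul]; exact cmVirial_le S _
      _ ≤ Real.sqrt (2 * cmKinetic S (γ t₁)) *
            (Real.sqrt (cmInertia S (γ t₁)) + Real.sqrt (2 * cmKinetic S (γ t₁)) * (t₂ - t₁)) := by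
          rw [hK t₂ (right_mem_Icc.2 h12)]
          exact mul_le_mul_of_nonneg_left hsqI (Real.sqrt_nonneg _)
      _ = _ := by rw [mul_add, ← mul_assoc, Real.mul_self_sqrt hK0]
  have hb1 := (neg_le_abs _).trans (abs_cmVirial_le S (γ t₁))
  rw [sqrt_two_mul_cmKinetic_mul] at hb1 ⊢
  have hid : ε * internalImpulse ε γ S (Ioc t₁ t₂) =
      2 * (cmVirial S (γ t₂) - cmVirial S (γ t₁) - 2 * cmKinetic S (γ t₁) * (t₂ - t₁)) := by
    have e2 : ε * internalImpulse ε γ S (Ioc t₁ t₂) = 2 * (ε / 2 * internalImpulse ε γ S (Ioc t₁ t₂)) := by ring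
    rw [e2, ← hjumps, eq_sub_of_add_eq' hbal.symm, hInt]
    ring
  rw [hid]
  linarith

/-- **The FED budget**: `ε · internalImpulse ≤ 2√(2K_S I_S)(t₁) + 2√(2K_S I_S)(t₂) + 2 R · externalImpulse`
when every member of `S` stays within `R` of the centre of mass on `[t₁, t₂]`. [cite: CIP1994, Lemma 4.2.3] -/
theorem fed_budget (h : IsHardSphereTrajectory G3 ε n γ) {t₁ t₂ R : ℝ} (h12 : t₁ ≤ t₂)
    (hR : ∀ t ∈ Icc t₁ t₂, ∀ a ∈ S, ‖(γ t a).1 - cmPos S (γ t)‖ ≤ R) :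
    ε * internalImpulse ε γ S (Ioc t₁ t₂) ≤
      2 * Real.sqrt (2 * cmKinetic S (γ t₁) * cmInertia S (γ t₁)) +
      2 * Real.sqrt (2 * cmKinetic S (γ t₂) * cmInertia S (γ t₂)) +
      2 * R * externalImpulse ε γ S (Ioc t₁ t₂) := by
  have hbal := cmVirial_sub_eq S h h12
  have hsum : ε / 2 * internalImpulse ε γ S (Ioc t₁ t₂) - R * externalImpulse ε γ S (Ioc t₁ t₂) ≤
      ∑ t ∈ (h.finite_collisionTimes_inter_Ioc t₁ t₂).toFinset, collisionJump (cmVirial S) γ t := by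
    rw [internalImpulse_eq_sum h, externalImpulse_eq_sum h, Finset.mul_sum, Finset.mul_sum,
      ← Finset.sum_sub_distrib]
    refine Finset.sum_le_sum fun t ht => ?_
    obtain ⟨htc, ht12⟩ := (Set.Finite.mem_toFinset _).1 ht
    exact le_collisionJump_cmVirial S h htc (hR t (Ioc_subset_Icc_self ht12))
  have hpos : 0 ≤ ∫ s in t₁..t₂, 2 * cmKinetic S (γ s) :=
    intervalIntegral.integral_nonneg h12 fun s _ => mul_nonneg zero_le_two (cmKinetic_nonneg S _)
  have hb2 := cmVirial_le S (γ t₂)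
  have hb1 := (neg_le_abs _).trans (abs_cmVirial_le S (γ t₁))
  have e2 : ε * internalImpulse ε γ S (Ioc t₁ t₂) = 2 * (ε / 2 * internalImpulse ε γ S (Ioc t₁ t₂)) := by ring
  have e3 : 2 * R * externalImpulse ε γ S (Ioc t₁ t₂) = 2 * (R * externalImpulse ε γ S (Ioc t₁ t₂)) := by ring
  rw [e2, e3]
  linarith

end Trajectory

/-! ## The stub -/

/-- **STUB `stub_clusterVirialBudget`** of line `explosion-limited-jamming` (crux `KineticWindowGronwall`,
stmt-AtomisticToContinuum-9282): the CM-frame Lagrange–Jacobi (Clausius virial) budget of a cluster of hard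
spheres in `ℝ³`, isolated and fed versions (`isolated_budget`, `fed_budget`). [cite: CIP1994, Lemma 4.2.3] -/
theorem stub_clusterVirialBudget : ClusterVirialBudget :=
  ⟨fun _ _ _ _ h S _ _ h12 hiso => isolated_budget S h h12 hiso,
    fun _ _ _ _ h S _ _ _ h12 hR => fed_budget S h h12 hR⟩

end Summit.AtomisticToContinuum.HydrodynamicLimit.Theorems.KineticWindowGronwallClusterVirial

end
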